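import Summits.QuantumFields.BalabanUV.Beta.WardLocusRecursive
import Summits.QuantumFields.BalabanUV.Beta.GAN24.ResolventLegCharges

/-!
# `BalabanUV.Beta.GAN24.ExitFaceCurrentSectorSplit` — binder row G-an2-4 ∕ (CONV-C), W-slot CT-W, conservation law (C)∕(C)sym AT ALL LEVELS, letter (R1) of this lineage's note
# `HOME/b2b-balaban-gan24-formalise-leaf-04/g68/EXIT-FACE-CURRENT-TOWER.md` §6: **THE WEIGHTED TWO-LEG ff CURRENT OF THE LEVEL-`(j+1)` TABLE `SrecAt (j+1)` SPLITS INTO ITS CUBIC (E) AND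
# Λ SECTORS — THE BORDER (VH) SECTOR HAS NO ff BLOCK** — so first-leg divergence-freeness of the `SrecAt (j+1)`-currents follows from that of the `e3OfK Lc G_j (SrecAt j)`-currents (the typed
# induction step `ExitFaceCurrentTowerStep`) and of the Λ-sector currents (the one remaining letter), for ANY bounded slot and leg weights.

NOT IN PRINT; OUR BOOKKEEPING ([folklore] `tsum` bookkeeping BY NAME over leaf-10∕an2's `WardLocusRecursive.SrecAt_succ ∕ locStencil_SrecAt`, an2's `SpineRooted.locStencil_e3OfK`,
`InterLevelTransport.locStencil_SLam`, `AveragingHessianKernelsRooted.biLoc_hessFFAt`, `BalabanStepJetsSucc.abs_lamCoeffK_le`; G-an2-4 formalisation swarm, leaf prover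
`b2b-balaban-gan24-formalise-leaf-04`, gen 68–69).  HONEST FRAMING (cell contract, verbatim): «discharging `BetaPertH` makes Bałaban's UV stability UNCONDITIONAL — a real constructive-QFT
result; it is NOT the continuum limit and NOT the Clay problem.»  HONEST DEPENDENCY (verbatim): «continuum YM on T⁴ ⇐ BetaPertH ∧ nine spine estimates (0/9 proved); BetaPertH ⇐ (D1) ∧ (D4) ∧
CAP+tail; G-an2-4 gates asym, D1 and NE2/3/4.»

WHAT ([folklore]; generic `d`, `[NeZero Lc]`, in-block root `r ∈ box Lc`, every `j`, all `cE cVH cΛ`, bounded weights `|h| ≤ Bh`, `|s| ≤ Bs`; 0 `def`, 0 cited facts, 0 `def … : Prop`, 0 sorry):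
§1 `summable_slot_locStencil`, `abs_tsum_slot_locStencil_le`, `summable_leg_slot_locStencil` (the two-leg current `Σ'_q h q·Σ'_u s u·T ν u v q a b` of a local stencil family converges
absolutely, inner and outer); `exists_locStencil_eSector`, `exists_locStencil_lamSector` (the two sectors of `SrecAt (j+1)` are local stencil families — an2's constants);
§2 `vhSAt_inl_inl` (`rfl`), **`tsum_current_SrecAt_succ`**: `Σ'_q h q·Σ'_u s u·SrecAt (j+1) ν u v q (inl κ′)(inl β) = (cE·wE_{j+1})·[same for e3OfK Lc G_j (SrecAt j)] + (cΛ·wΛ_{j+1})·[same for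
the Λ-sector]`; §3 **`divFree_current_SrecAt_succ_of_sectors`**: first-leg divergence-freeness at `v` of the `SrecAt (j+1)`-current from that of the two sector currents; §4 the same at LEVEL 0
(`S0NAt = cE•wilsonA + cVH•vhSAt + cΛ•SLam Lc (lamCoeffOf (KInv Lc) Lc) hessFFAt`; Wilson locality = an3∕an2 `locStencil_wilsonA` BY NAME): `exists_locStencil_lamSectorZero`, **`tsum_current_S0NAt`**,
**`divFree_current_S0NAt_of_sectors`** (the E-sector here is an3's bare Wilson cubic table — T0 `WilsonEdgeCurrentDivFree`).  Asserts NO value of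
Bałaban's tables; discharges NOTHING of (C)sym ∕ (Q-D) ∕ (Q-D-rate) ∕ «T2Shape» ∕ «T2Drift» ∕ (hW, hWall); NEVER «G-an2-4 closed» as (CONV-C); NOT D1, NOT `BetaPertH`, NOT continuum, NOT Clay.
2026-08-23; no existing file touched.
-/

noncomputable section

open Finset
open scoped BigOperators
open Literature.MathematicalPhysics.QuantumFieldTheory
open Literature.MathematicalPhysics.QuantumFieldTheory.Balaban1983to89
open Literature.MathematicalPhysics.QuantumFieldTheory.Balaban1983to89.Beta
open B12Sec2to5 (l1 l1_nonneg)
open ExpKernelCalculus (Site MKer Decays BiLoc VertexFamily Zl Zl_nonneg summable_exp_shift' tsum_exp_shift' l1_sub_symm l1_sub_triangle)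
open OneStepResolventKernel (Fib LocStencil KInv decays_KInv decays_mono biLoc_mono)
open OneStepKernelFamily (KInvStep decays_KInvStep)
open AffineAveraging (box toSite)
open AveragingHessianKernels (ell)
open AveragingHessianKernelsRooted (vhSAt hessFFAt biLoc_hessFFAt)
open InterLevelTransport (SLam locStencil_SLam)
open BalabanStepJets (lamCoeffOf abs_lamCoeffOf_le locStencil_mono)
open StepJetData (wilsonA wBound locStencil_wilsonA)
open BalabanStepJetsSucc (E2 decays_E2 lamCoeffK abs_lamCoeffK_le wE wVH wΛ)
open B6BondElimination (unitVec)
open Summit.QuantumFields.BalabanUV.Beta.AxialDressingRooted (coDressKBmAt decays_coDressKBmAt_KInvStep)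
open Summit.QuantumFields.BalabanUV.Beta.SpineRooted (S0NAt e3OfK locStencil_e3OfK)
open Summit.QuantumFields.BalabanUV.Beta.WardLocusRecursive (SrecAt SrecAt_succ locStencil_SrecAt)
open Summit.QuantumFields.BalabanUV.Beta.GAN24.ResolventLegCharges (summable_exp_coarse')

namespace Summit.QuantumFields.BalabanUV.Beta.GAN24.ExitFaceCurrentSectorSplit

variable {d : ℕ} {Lc : ℕ} [NeZero Lc] {r : Fin (d + 1) → ℕ}

/-! ## §1 Convergence of the two-leg current of a local stencil family; the sectors are local -/

omit [NeZero Lc] in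
/-- [folklore] For a local stencil family and a bounded slot weight, `u ↦ s u·T ν u v q a b` is summable. -/
theorem summable_slot_locStencil {T : Fin (d + 1) → Site (d + 1) → MKer (d + 1) (Fib d)} {Cs δ : ℝ} (hT : LocStencil T Cs δ) (hδ : 0 < δ)
    {s : Site (d + 1) → ℝ} {Bs : ℝ} (hs : ∀ u, |s u| ≤ Bs) (ν : Fin (d + 1)) (v q : Site (d + 1)) (a b : Fib d) :
    Summable fun u : Site (d + 1) => s u * T ν u v q a b := by
  have hCs : 0 ≤ Cs := (hT 0 0).nonneg (Sum.inl 0)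
  have hBs : 0 ≤ Bs := (abs_nonneg _).trans (hs 0)
  refine Summable.of_norm_bounded (((summable_exp_shift' hδ v).congr fun u => by rw [l1_sub_symm]).mul_left (Bs * Cs)) (fun u => ?_)
  rw [Real.norm_eq_abs, abs_mul]
  have h := hT ν u v q a b
  have h' : |T ν u v q a b| ≤ Cs * Real.exp (-δ * l1 (v - u)) := by
    refine h.trans (mul_le_mul_of_nonneg_left (Real.exp_le_exp.2 ?_) hCs)
    nlinarith [l1_nonneg (v - u), l1_nonneg (q - u)]
  calc |s u| * |T ν u v q a b| ≤ Bs * (Cs * Real.exp (-δ * l1 (v - u))) := mul_le_mul (hs u) h' (abs_nonneg _) hBs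
    _ = Bs * Cs * Real.exp (-δ * l1 (v - u)) := by ring

omit [NeZero Lc] in
/-- [folklore] … with the tail bound `|Σ'_u s u·T ν u v q a b| ≤ Bs·Cs·Zl(δ/2)·e^{−(δ/2)|q − v|}`. -/
theorem abs_tsum_slot_locStencil_le {T : Fin (d + 1) → Site (d + 1) → MKer (d + 1) (Fib d)} {Cs δ : ℝ} (hT : LocStencil T Cs δ) (hδ : 0 < δ)
    {s : Site (d + 1) → ℝ} {Bs : ℝ} (hs : ∀ u, |s u| ≤ Bs) (ν : Fin (d + 1)) (v q : Site (d + 1)) (a b : Fib d) :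
    |∑' u : Site (d + 1), s u * T ν u v q a b| ≤ Bs * Cs * Zl (d + 1) (δ / 2) * Real.exp (-(δ / 2) * l1 (q - v)) := by
  have hCs : 0 ≤ Cs := (hT 0 0).nonneg (Sum.inl 0)
  have hBs : 0 ≤ Bs := (abs_nonneg _).trans (hs 0)
  have hδ2 : 0 < δ / 2 := by positivity
  -- termwise: `|s u·T| ≤ Bs·Cs·e^{−(δ/2)|q−v|}·e^{−(δ/2)|v−u|}`
  have hmaj : ∀ u : Site (d + 1), ‖s u * T ν u v q a b‖ ≤ Bs * Cs * Real.exp (-(δ / 2) * l1 (q - v)) * Real.exp (-(δ / 2) * l1 (u - v)) := by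
    intro u
    rw [Real.norm_eq_abs, abs_mul]
    have h := hT ν u v q a b
    have htri : l1 (q - v) ≤ l1 (v - u) + l1 (q - u) := by
      have := l1_sub_triangle q u v
      rw [l1_sub_symm u v] at this
      linarith
    have h' : |T ν u v q a b| ≤ Cs * (Real.exp (-(δ / 2) * l1 (q - v)) * Real.exp (-(δ / 2) * l1 (u - v))) := by
      refine h.trans (mul_le_mul_of_nonneg_left ?_ hCs)
      rw [← Real.exp_add]
      refine Real.exp_le_exp.2 ?_
      rw [l1_sub_symm u v]
      nlinarith [l1_nonneg (v - u), l1_nonneg (q - u), l1_nonneg (q - v)]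
    calc |s u| * |T ν u v q a b| ≤ Bs * (Cs * (Real.exp (-(δ / 2) * l1 (q - v)) * Real.exp (-(δ / 2) * l1 (u - v)))) := mul_le_mul (hs u) h' (abs_nonneg _) hBs
      _ = _ := by ring
  have hsum : Summable fun u : Site (d + 1) => Bs * Cs * Real.exp (-(δ / 2) * l1 (q - v)) * Real.exp (-(δ / 2) * l1 (u - v)) :=
    (summable_exp_shift' hδ2 v).mul_left _
  calc |∑' u : Site (d + 1), s u * T ν u v q a b| = ‖∑' u : Site (d + 1), s u * T ν u v q a b‖ := (Real.norm_eq_abs _).symm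
    _ ≤ ∑' u : Site (d + 1), Bs * Cs * Real.exp (-(δ / 2) * l1 (q - v)) * Real.exp (-(δ / 2) * l1 (u - v)) := tsum_of_norm_bounded hsum.hasSum hmaj
    _ = Bs * Cs * Real.exp (-(δ / 2) * l1 (q - v)) * Zl (d + 1) (δ / 2) := by rw [tsum_mul_left, tsum_exp_shift']
    _ = _ := by ring

omit [NeZero Lc] in
/-- [folklore] For a local stencil family and bounded weights, `q ↦ h q·Σ'_u s u·T ν u v q a b` is summable. -/
theorem summable_leg_slot_locStencil {T : Fin (d + 1) → Site (d + 1) → MKer (d + 1) (Fib d)} {Cs δ : ℝ} (hT : LocStencil T Cs δ) (hδ : 0 < δ)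
    {h s : Site (d + 1) → ℝ} {Bh Bs : ℝ} (hh : ∀ q, |h q| ≤ Bh) (hs : ∀ u, |s u| ≤ Bs) (ν : Fin (d + 1)) (v : Site (d + 1)) (a b : Fib d) :
    Summable fun q : Site (d + 1) => h q * ∑' u : Site (d + 1), s u * T ν u v q a b := by
  have hBh : 0 ≤ Bh := (abs_nonneg _).trans (hh 0)
  have hδ2 : 0 < δ / 2 := by positivity
  refine Summable.of_norm_bounded ((summable_exp_shift' hδ2 v).mul_left (Bh * (Bs * Cs * Zl (d + 1) (δ / 2)))) (fun q => ?_)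
  rw [Real.norm_eq_abs, abs_mul]
  calc |h q| * |∑' u : Site (d + 1), s u * T ν u v q a b| ≤ Bh * (Bs * Cs * Zl (d + 1) (δ / 2) * Real.exp (-(δ / 2) * l1 (q - v))) :=
        mul_le_mul (hh q) (abs_tsum_slot_locStencil_le hT hδ hs ν v q a b) (abs_nonneg _) hBh
    _ = _ := by ring

/-- [folklore] The cubic (E) sector of `SrecAt (j+1)` is a local stencil family (an2's `locStencil_e3OfK` on `locStencil_SrecAt j`). -/
theorem exists_locStencil_eSector (hr : r ∈ box (d + 1) Lc) (cE cVH cΛ : ℝ) (j : ℕ) :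
    ∃ C δ : ℝ, 0 < δ ∧ LocStencil (e3OfK Lc (coDressKBmAt (toSite r) Lc (KInvStep (d := d) Lc j)) (SrecAt d Lc (toSite r) cE cVH cΛ j)) C δ := by
  have hLc : 1 ≤ Lc := Nat.one_le_iff_ne_zero.mpr (NeZero.ne Lc)
  obtain ⟨Cs, δs, hδs, hS⟩ := locStencil_SrecAt hLc hr cE cVH cΛ j
  obtain ⟨C₁, δ₁, hδ₁, h1⟩ := locStencil_e3OfK (N := Lc) hLc (decays_coDressKBmAt_KInvStep (d := d) hr j) hS hδs
  exact ⟨C₁, δ₁, hδ₁, h1⟩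

/-- [folklore] The Λ sector of `SrecAt (j+1)` is a local stencil family (an2's `locStencil_SLam`, constants as in `locStencil_SrecAt`). -/
theorem exists_locStencil_lamSector (hr : r ∈ box (d + 1) Lc) (j : ℕ) :
    ∃ C δ : ℝ, 0 < δ ∧ LocStencil (SLam Lc (lamCoeffK (KInvStep (d := d) Lc (j + 1)) (E2 d Lc (j + 1)) Lc) (fun μ y => hessFFAt (toSite r) Lc μ y)) C δ := by
  have hLc : 1 ≤ Lc := Nat.one_le_iff_ne_zero.mpr (NeZero.ne Lc)
  obtain ⟨δA, CA, hδA, hCA, hA⟩ := decays_KInvStep (Lc := Lc) (d := d) (j + 1)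
  obtain ⟨δE, CE, hδE, hCE, hE⟩ := decays_E2 (d := d) (Lc := Lc) (j + 1)
  obtain ⟨n, hn0, hnA, hnE⟩ : ∃ n : ℝ, 0 < n ∧ n ≤ δA ∧ n ≤ δE := ⟨min δA δE, lt_min hδA hδE, min_le_left _ _, min_le_right _ _⟩
  have hA' : Decays (KInvStep (d := d) Lc (j + 1)) CA n := decays_mono hA hCA le_rfl hnA
  have hE' : Decays (E2 d Lc (j + 1)) CE n := decays_mono hE hCE le_rfl hnE
  have hc := abs_lamCoeffK_le hA' hE' hn0 Lc
  have hn2 : (0 : ℝ) ≤ n / 2 := by positivity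
  have hQ : VertexFamily (fun μ y => hessFFAt (toSite r) Lc μ y) Lc
      (2 * (ell (d + 1) Lc : ℝ) ^ 2 * Real.exp (4 * ((d : ℝ) + 1) * Lc * (n / 2))) (n / 2) :=
    fun μ y => biLoc_hessFFAt hLc μ y hr hn2
  have h3 := locStencil_SLam (N := Lc) hc hQ (by positivity)
    (mul_nonneg (mul_nonneg (Nat.cast_nonneg _) (mul_nonneg hCA hCE)) (Zl_nonneg (by linarith)))
  exact ⟨_, _, by positivity, h3⟩

/-! ## §2 The sector split of the current -/

omit [NeZero Lc] in
/-- [folklore] The border (VH) table has no ff block. -/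
theorem vhSAt_inl_inl (ρ : Fin (d + 1) → ℤ) (κ : Fin (d + 1)) (u x z : Site (d + 1)) (α β : Fin (d + 1)) :
    vhSAt ρ d Lc rfl κ u x z (Sum.inl α) (Sum.inl β) = 0 := rfl

/-- [folklore] **THE SECTOR SPLIT OF THE WEIGHTED TWO-LEG ff CURRENT OF `SrecAt (j+1)`** (bounded weights; the VH sector drops out):
`Σ'_q h q·Σ'_u s u·SrecAt (j+1) ν u v q (inl κ′)(inl β) = (cE·wE_{j+1})·Σ'_q h q·Σ'_u s u·e3OfK Lc G_j (SrecAt j) ν u v q (inl κ′)(inl β) + (cΛ·wΛ_{j+1})·Σ'_q h q·Σ'_u s u·S^Λ_{j+1} ν u v q (inl κ′)(inl β)`. -/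
theorem tsum_current_SrecAt_succ (hr : r ∈ box (d + 1) Lc) (cE cVH cΛ : ℝ) (j : ℕ) (ν β κ' : Fin (d + 1))
    {h s : Site (d + 1) → ℝ} {Bh Bs : ℝ} (hh : ∀ q, |h q| ≤ Bh) (hs : ∀ u, |s u| ≤ Bs) (v : Site (d + 1)) :
    ∑' q : Site (d + 1), h q * ∑' u : Site (d + 1), s u * SrecAt d Lc (toSite r) cE cVH cΛ (j + 1) ν u v q (Sum.inl κ') (Sum.inl β) =
      (cE * wE d Lc (j + 1)) * ∑' q : Site (d + 1), h q * ∑' u : Site (d + 1), s u *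
          e3OfK Lc (coDressKBmAt (toSite r) Lc (KInvStep (d := d) Lc j)) (SrecAt d Lc (toSite r) cE cVH cΛ j) ν u v q (Sum.inl κ') (Sum.inl β)
        + (cΛ * wΛ d Lc (j + 1)) * ∑' q : Site (d + 1), h q * ∑' u : Site (d + 1), s u *
          SLam Lc (lamCoeffK (KInvStep (d := d) Lc (j + 1)) (E2 d Lc (j + 1)) Lc) (fun μ y => hessFFAt (toSite r) Lc μ y) ν u v q (Sum.inl κ') (Sum.inl β) := by
  obtain ⟨C₁, δ₁, hδ₁, h1⟩ := exists_locStencil_eSector (d := d) hr cE cVH cΛ j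
  obtain ⟨C₃, δ₃, hδ₃, h3⟩ := exists_locStencil_lamSector (d := d) (Lc := Lc) hr j
  -- pointwise split of the table entry
  have ept : ∀ u q : Site (d + 1), SrecAt d Lc (toSite r) cE cVH cΛ (j + 1) ν u v q (Sum.inl κ') (Sum.inl β) =
      (cE * wE d Lc (j + 1)) * e3OfK Lc (coDressKBmAt (toSite r) Lc (KInvStep (d := d) Lc j)) (SrecAt d Lc (toSite r) cE cVH cΛ j) ν u v q (Sum.inl κ') (Sum.inl β)
        + (cΛ * wΛ d Lc (j + 1)) * SLam Lc (lamCoeffK (KInvStep (d := d) Lc (j + 1)) (E2 d Lc (j + 1)) Lc) (fun μ y => hessFFAt (toSite r) Lc μ y) ν u v q (Sum.inl κ') (Sum.inl β) := by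
    intro u q
    rw [SrecAt_succ]
    simp only [Pi.add_apply, Pi.smul_apply, smul_eq_mul, vhSAt_inl_inl, mul_zero, add_zero]
  -- inner split
  have einner : ∀ q : Site (d + 1), ∑' u : Site (d + 1), s u * SrecAt d Lc (toSite r) cE cVH cΛ (j + 1) ν u v q (Sum.inl κ') (Sum.inl β) =
      (cE * wE d Lc (j + 1)) * ∑' u : Site (d + 1), s u *
          e3OfK Lc (coDressKBmAt (toSite r) Lc (KInvStep (d := d) Lc j)) (SrecAt d Lc (toSite r) cE cVH cΛ j) ν u v q (Sum.inl κ') (Sum.inl β)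
        + (cΛ * wΛ d Lc (j + 1)) * ∑' u : Site (d + 1), s u *
          SLam Lc (lamCoeffK (KInvStep (d := d) Lc (j + 1)) (E2 d Lc (j + 1)) Lc) (fun μ y => hessFFAt (toSite r) Lc μ y) ν u v q (Sum.inl κ') (Sum.inl β) := by
    intro q
    have e : ∀ u : Site (d + 1), s u * SrecAt d Lc (toSite r) cE cVH cΛ (j + 1) ν u v q (Sum.inl κ') (Sum.inl β) =
        (cE * wE d Lc (j + 1)) * (s u * e3OfK Lc (coDressKBmAt (toSite r) Lc (KInvStep (d := d) Lc j)) (SrecAt d Lc (toSite r) cE cVH cΛ j) ν u v q (Sum.inl κ') (Sum.inl β))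
          + (cΛ * wΛ d Lc (j + 1)) * (s u * SLam Lc (lamCoeffK (KInvStep (d := d) Lc (j + 1)) (E2 d Lc (j + 1)) Lc) (fun μ y => hessFFAt (toSite r) Lc μ y) ν u v q (Sum.inl κ') (Sum.inl β)) := by
      intro u; rw [ept u q]; ring
    rw [tsum_congr e, ((summable_slot_locStencil h1 hδ₁ hs ν v q _ _).mul_left _).tsum_add ((summable_slot_locStencil h3 hδ₃ hs ν v q _ _).mul_left _),
      tsum_mul_left, tsum_mul_left]
  -- outer split
  have e : ∀ q : Site (d + 1), h q * ∑' u : Site (d + 1), s u * SrecAt d Lc (toSite r) cE cVH cΛ (j + 1) ν u v q (Sum.inl κ') (Sum.inl β) =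
      (cE * wE d Lc (j + 1)) * (h q * ∑' u : Site (d + 1), s u *
          e3OfK Lc (coDressKBmAt (toSite r) Lc (KInvStep (d := d) Lc j)) (SrecAt d Lc (toSite r) cE cVH cΛ j) ν u v q (Sum.inl κ') (Sum.inl β))
        + (cΛ * wΛ d Lc (j + 1)) * (h q * ∑' u : Site (d + 1), s u *
          SLam Lc (lamCoeffK (KInvStep (d := d) Lc (j + 1)) (E2 d Lc (j + 1)) Lc) (fun μ y => hessFFAt (toSite r) Lc μ y) ν u v q (Sum.inl κ') (Sum.inl β)) := by
    intro q; rw [einner q]; ring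
  rw [tsum_congr e, ((summable_leg_slot_locStencil h1 hδ₁ hh hs ν v _ _).mul_left _).tsum_add ((summable_leg_slot_locStencil h3 hδ₃ hh hs ν v _ _).mul_left _),
    tsum_mul_left, tsum_mul_left]

/-! ## §3 Divergence-freeness from the sectors -/

/-- [folklore] **FIRST-LEG DIVERGENCE-FREENESS OF THE `SrecAt (j+1)`-CURRENT FROM ITS TWO SECTORS** (bounded weights, any `cE cVH cΛ`, at a site `v`). -/
theorem divFree_current_SrecAt_succ_of_sectors (hr : r ∈ box (d + 1) Lc) (cE cVH cΛ : ℝ) (j : ℕ) (ν β : Fin (d + 1))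
    {h s : Site (d + 1) → ℝ} {Bh Bs : ℝ} (hh : ∀ q, |h q| ≤ Bh) (hs : ∀ u, |s u| ≤ Bs) (v : Site (d + 1))
    (hE : ∑ κ' : Fin (d + 1),
      ((∑' q : Site (d + 1), h q * ∑' u : Site (d + 1), s u *
          e3OfK Lc (coDressKBmAt (toSite r) Lc (KInvStep (d := d) Lc j)) (SrecAt d Lc (toSite r) cE cVH cΛ j) ν u v q (Sum.inl κ') (Sum.inl β))
        - ∑' q : Site (d + 1), h q * ∑' u : Site (d + 1), s u *
          e3OfK Lc (coDressKBmAt (toSite r) Lc (KInvStep (d := d) Lc j)) (SrecAt d Lc (toSite r) cE cVH cΛ j) ν u (v - unitVec κ') q (Sum.inl κ') (Sum.inl β)) = 0)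
    (hΛ : ∑ κ' : Fin (d + 1),
      ((∑' q : Site (d + 1), h q * ∑' u : Site (d + 1), s u *
          SLam Lc (lamCoeffK (KInvStep (d := d) Lc (j + 1)) (E2 d Lc (j + 1)) Lc) (fun μ y => hessFFAt (toSite r) Lc μ y) ν u v q (Sum.inl κ') (Sum.inl β))
        - ∑' q : Site (d + 1), h q * ∑' u : Site (d + 1), s u *
          SLam Lc (lamCoeffK (KInvStep (d := d) Lc (j + 1)) (E2 d Lc (j + 1)) Lc) (fun μ y => hessFFAt (toSite r) Lc μ y) ν u (v - unitVec κ') q (Sum.inl κ') (Sum.inl β)) = 0) :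
    ∑ κ' : Fin (d + 1),
      ((∑' q : Site (d + 1), h q * ∑' u : Site (d + 1), s u * SrecAt d Lc (toSite r) cE cVH cΛ (j + 1) ν u v q (Sum.inl κ') (Sum.inl β))
        - ∑' q : Site (d + 1), h q * ∑' u : Site (d + 1), s u * SrecAt d Lc (toSite r) cE cVH cΛ (j + 1) ν u (v - unitVec κ') q (Sum.inl κ') (Sum.inl β)) = 0 := by
  have e1 := fun (κ' : Fin (d + 1)) (w : Site (d + 1)) => tsum_current_SrecAt_succ (d := d) hr cE cVH cΛ j ν β κ' hh hs w
  rw [Finset.sum_congr rfl fun κ' _ => by rw [e1 κ' v, e1 κ' (v - unitVec κ')]]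
  have e : ∀ (a b A B A' B' : ℝ), (a * A + b * B) - (a * A' + b * B') = a * (A - A') + b * (B - B') := by intros; ring
  simp only [e]
  rw [Finset.sum_add_distrib, ← Finset.mul_sum, ← Finset.mul_sum, hE, hΛ, mul_zero, mul_zero, add_zero]

/-! ## §4 Level `0`: the rooted native spine `S0NAt` -/

/-- [folklore] The level-`0` Λ sector is a local stencil family (an2's constants, as in `locStencil_S0NAt`). -/
theorem exists_locStencil_lamSectorZero (hr : r ∈ box (d + 1) Lc) :
    ∃ C δ : ℝ, 0 < δ ∧ LocStencil (SLam Lc (lamCoeffOf (KInv (N := Lc) (d := d)) Lc) (fun μ y => hessFFAt (toSite r) Lc μ y)) C δ := by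
  have hLc : 1 ≤ Lc := Nat.one_le_iff_ne_zero.mpr (NeZero.ne Lc)
  obtain ⟨δ₀, C, hδ₀, hC, hdec⟩ := decays_KInv (N := Lc) (d := d)
  have hc := abs_lamCoeffOf_le (N := Lc) hdec hC hδ₀.le
  have hQ : VertexFamily (fun μ y => hessFFAt (toSite r) Lc μ y) Lc
      (2 * (ell (d + 1) Lc : ℝ) ^ 2 * Real.exp (4 * ((d : ℝ) + 1) * Lc * δ₀)) δ₀ :=
    fun μ y => biLoc_hessFFAt hLc μ y hr hδ₀.le
  have h3 := locStencil_SLam (N := Lc) hc hQ hδ₀ (mul_nonneg (mul_nonneg (by positivity) hC) (Real.exp_pos _).le)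
  exact ⟨_, _, by positivity, h3⟩

/-- [folklore] **THE SECTOR SPLIT AT LEVEL `0`**: `Σ'_q h q·Σ'_u s u·S0NAt ν u v q (inl κ′)(inl β) = cE·[same for wilsonA] + cΛ·[same for S^Λ_0]` (the VH sector drops out). -/
theorem tsum_current_S0NAt (hr : r ∈ box (d + 1) Lc) (cE cVH cΛ : ℝ) (ν β κ' : Fin (d + 1))
    {h s : Site (d + 1) → ℝ} {Bh Bs : ℝ} (hh : ∀ q, |h q| ≤ Bh) (hs : ∀ u, |s u| ≤ Bs) (v : Site (d + 1)) :
    ∑' q : Site (d + 1), h q * ∑' u : Site (d + 1), s u * S0NAt d Lc (toSite r) cE cVH cΛ ν u v q (Sum.inl κ') (Sum.inl β) =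
      cE * ∑' q : Site (d + 1), h q * ∑' u : Site (d + 1), s u * wilsonA d ν u v q (Sum.inl κ') (Sum.inl β)
        + cΛ * ∑' q : Site (d + 1), h q * ∑' u : Site (d + 1), s u *
          SLam Lc (lamCoeffOf (KInv (N := Lc) (d := d)) Lc) (fun μ y => hessFFAt (toSite r) Lc μ y) ν u v q (Sum.inl κ') (Sum.inl β) := by
  have h1 := locStencil_wilsonA (d := d) zero_le_one
  have hδ₁ : (0 : ℝ) < 1 := one_pos
  obtain ⟨C₃, δ₃, hδ₃, h3⟩ := exists_locStencil_lamSectorZero (d := d) (Lc := Lc) hr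
  have ept : ∀ u q : Site (d + 1), S0NAt d Lc (toSite r) cE cVH cΛ ν u v q (Sum.inl κ') (Sum.inl β) =
      cE * wilsonA d ν u v q (Sum.inl κ') (Sum.inl β)
        + cΛ * SLam Lc (lamCoeffOf (KInv (N := Lc) (d := d)) Lc) (fun μ y => hessFFAt (toSite r) Lc μ y) ν u v q (Sum.inl κ') (Sum.inl β) := by
    intro u q
    simp only [S0NAt, Pi.add_apply, Pi.smul_apply, smul_eq_mul, vhSAt_inl_inl, mul_zero, add_zero]
  have einner : ∀ q : Site (d + 1), ∑' u : Site (d + 1), s u * S0NAt d Lc (toSite r) cE cVH cΛ ν u v q (Sum.inl κ') (Sum.inl β) =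
      cE * ∑' u : Site (d + 1), s u * wilsonA d ν u v q (Sum.inl κ') (Sum.inl β)
        + cΛ * ∑' u : Site (d + 1), s u *
          SLam Lc (lamCoeffOf (KInv (N := Lc) (d := d)) Lc) (fun μ y => hessFFAt (toSite r) Lc μ y) ν u v q (Sum.inl κ') (Sum.inl β) := by
    intro q
    have e : ∀ u : Site (d + 1), s u * S0NAt d Lc (toSite r) cE cVH cΛ ν u v q (Sum.inl κ') (Sum.inl β) =
        cE * (s u * wilsonA d ν u v q (Sum.inl κ') (Sum.inl β))
          + cΛ * (s u * SLam Lc (lamCoeffOf (KInv (N := Lc) (d := d)) Lc) (fun μ y => hessFFAt (toSite r) Lc μ y) ν u v q (Sum.inl κ') (Sum.inl β)) := by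
      intro u; rw [ept u q]; ring
    rw [tsum_congr e, ((summable_slot_locStencil h1 hδ₁ hs ν v q _ _).mul_left _).tsum_add ((summable_slot_locStencil h3 hδ₃ hs ν v q _ _).mul_left _),
      tsum_mul_left, tsum_mul_left]
  have e : ∀ q : Site (d + 1), h q * ∑' u : Site (d + 1), s u * S0NAt d Lc (toSite r) cE cVH cΛ ν u v q (Sum.inl κ') (Sum.inl β) =
      cE * (h q * ∑' u : Site (d + 1), s u * wilsonA d ν u v q (Sum.inl κ') (Sum.inl β))
        + cΛ * (h q * ∑' u : Site (d + 1), s u *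
          SLam Lc (lamCoeffOf (KInv (N := Lc) (d := d)) Lc) (fun μ y => hessFFAt (toSite r) Lc μ y) ν u v q (Sum.inl κ') (Sum.inl β)) := by
    intro q; rw [einner q]; ring
  rw [tsum_congr e, ((summable_leg_slot_locStencil h1 hδ₁ hh hs ν v _ _).mul_left _).tsum_add ((summable_leg_slot_locStencil h3 hδ₃ hh hs ν v _ _).mul_left _),
    tsum_mul_left, tsum_mul_left]

/-- [folklore] **FIRST-LEG DIVERGENCE-FREENESS OF THE `S0NAt`-CURRENT FROM ITS WILSON AND Λ SECTORS** (bounded weights, any `cE cVH cΛ`, at a site `v`). -/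
theorem divFree_current_S0NAt_of_sectors (hr : r ∈ box (d + 1) Lc) (cE cVH cΛ : ℝ) (ν β : Fin (d + 1))
    {h s : Site (d + 1) → ℝ} {Bh Bs : ℝ} (hh : ∀ q, |h q| ≤ Bh) (hs : ∀ u, |s u| ≤ Bs) (v : Site (d + 1))
    (hE : ∑ κ' : Fin (d + 1),
      ((∑' q : Site (d + 1), h q * ∑' u : Site (d + 1), s u * wilsonA d ν u v q (Sum.inl κ') (Sum.inl β))
        - ∑' q : Site (d + 1), h q * ∑' u : Site (d + 1), s u * wilsonA d ν u (v - unitVec κ') q (Sum.inl κ') (Sum.inl β)) = 0)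
    (hΛ : ∑ κ' : Fin (d + 1),
      ((∑' q : Site (d + 1), h q * ∑' u : Site (d + 1), s u *
          SLam Lc (lamCoeffOf (KInv (N := Lc) (d := d)) Lc) (fun μ y => hessFFAt (toSite r) Lc μ y) ν u v q (Sum.inl κ') (Sum.inl β))
        - ∑' q : Site (d + 1), h q * ∑' u : Site (d + 1), s u *
          SLam Lc (lamCoeffOf (KInv (N := Lc) (d := d)) Lc) (fun μ y => hessFFAt (toSite r) Lc μ y) ν u (v - unitVec κ') q (Sum.inl κ') (Sum.inl β)) = 0) :
    ∑ κ' : Fin (d + 1),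
      ((∑' q : Site (d + 1), h q * ∑' u : Site (d + 1), s u * S0NAt d Lc (toSite r) cE cVH cΛ ν u v q (Sum.inl κ') (Sum.inl β))
        - ∑' q : Site (d + 1), h q * ∑' u : Site (d + 1), s u * S0NAt d Lc (toSite r) cE cVH cΛ ν u (v - unitVec κ') q (Sum.inl κ') (Sum.inl β)) = 0 := by
  have e1 := fun (κ' : Fin (d + 1)) (w : Site (d + 1)) => tsum_current_S0NAt (d := d) hr cE cVH cΛ ν β κ' hh hs w
  rw [Finset.sum_congr rfl fun κ' _ => by rw [e1 κ' v, e1 κ' (v - unitVec κ')]]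
  have e : ∀ (a b A B A' B' : ℝ), (a * A + b * B) - (a * A' + b * B') = a * (A - A') + b * (B - B') := by intros; ring
  simp only [e]
  rw [Finset.sum_add_distrib, ← Finset.mul_sum, ← Finset.mul_sum, hE, hΛ, mul_zero, mul_zero, add_zero]

end Summit.QuantumFields.BalabanUV.Beta.GAN24.ExitFaceCurrentSectorSplit
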